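import Summits.QuantumFields.YangMills.Theorems.FlatTubeReductionSlowFibreTailCrude
import Summits.QuantumFields.YangMills.Theorems.FlatTubeReductionSlowCoreInclusionUniform
import Summits.QuantumFields.YangMills.Theorems.FlatTubeReductionReferenceMassBoundsMirror
import HarnessLib

/-!
# The two TAIL hypotheses of the core+tail sandwich for the rate twin's core `S′ = {βkin ≤ T} ∩ {β‖v̂‖² ≤ T} ∩ {β‖v̂′‖² ≤ T} ∩ supp(Ω⊗Ω⊗fpWeight)`, from the three-piece tails
# (route `FlatTubeReduction`, crux K1 `NearFlatRatioLaw` stmt-QuantumFields-24720; seat `ym-line-ftr-p1` g13; rate twin «ratepack-v3 / frozen fibres»; R2b1 RECORD rung — no summit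
# statement is proved here)

WHY (memo `Cruxes/NearFlatRatioLaw/Lines/ratepack-v3-frozen-g12.md` §6 (F7)).  `…DiagonalRatioOfLevelBounds.fpBOKernel_diag_two_sided_of_levelBounds` takes `htail1 : ∫_{S′ᶜ}ρ₁ ≤ η∫ρ₁` and
`htailu : ∫_{S′ᶜ}ρ_w/K(w,w) ≤ η·f(1)`.  Off the support the densities vanish, so `S′ᶜ` costs the kinetic tail plus the two fibre tails:
* `indicator_compl_core_le` — pointwise `𝟙_{(A∩B∩C∩D)ᶜ}·ρ ≤ 𝟙_{Aᶜ}ρ + 𝟙_{Bᶜ}ρ + 𝟙_{Cᶜ}ρ` when `ρ ≥ 0` vanishes off `D`; `setIntegral_compl_core_le` its integrated form;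
* ★★ `reference_core_tail_le` — `∫_{S′ᶜ}ρ₁ ≤ (η₁ + η₂ + η₃)∫ρ₁` from the kinetic tail (`reference_tail_le`), the v-fibre tail (`reference_fibre_tail_le`) and the v′-fibre tail
  (`reference_fibre_tail_le'`), passed as hypotheses;
* ★★ `slow_core_tail_le` — `∫_{S′ᶜ}ρ_w/K(w,w) ≤ X₁ + X₂ + X₃` from the slow kinetic tail at level `T′` (`slow_reference_tail_abs_le`), the two crude slow fibre tails
  (`slow_mass_on_fibreSets_le`) and the uniform core inclusion `{βkin₁ > T} ∩ {β‖v̂‖², β‖v̂′‖² ≤ T} ∩ pinned ⊆ {βkin_w > T′}` (`kinDefect_slow_gt_of_one_gt`, `T/β = 2T′/β + 8|E|τ_u²Φ²`).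
HONEST FRAMING: set algebra + bookkeeping; femto rung R2b1 (RECORD label); not infinite volume, not a gap, not Clay.  No defs, no named facts, no `sorry`.
-/

set_option autoImplicit false

noncomputable section

open MeasureTheory Filter Topology Real Set
open scoped BigOperators ENNReal
open Literature.MathematicalPhysics.QuantumFieldTheory
open Literature.MathematicalPhysics.QuantumLattice

namespace Summit.QuantumFields.YangMills.Theorems.FemtoTransferGap.RateTube

open Summit.QuantumFields.YangMills.Theorems.FemtoTransferGap
open Summit.QuantumFields.YangMills.Theorems.FemtoTransferGap.TwoLattice
open Summit.QuantumFields.YangMills.Theorems.FemtoTransferGap.TwoLattice.ConstTube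
open Summit.QuantumFields.YangMills.Theorems.FemtoTransferGap.TwoLattice.Avg
open Summit.QuantumFields.YangMills.Theorems.FemtoTransferGap.TwoLattice.Cov
open Summit.QuantumFields.YangMills.Theorems.FemtoTransferGap.TwoLattice.Stiff (LinkSpace)

variable {L : ℕ} [NeZero L]

/-! ## §1 Set algebra: the complement of a four-fold core -/

omit [NeZero L] in
/-- Pointwise: `𝟙_{(A∩B∩C∩D)ᶜ}·ρ ≤ 𝟙_{Aᶜ}ρ + 𝟙_{Bᶜ}ρ + 𝟙_{Cᶜ}ρ` for `ρ ≥ 0` vanishing off `D`. [folklore] -/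
theorem indicator_compl_core_le {X : Type*} {A B C D : Set X} {ρ : X → ℝ} (hρ0 : ∀ x, 0 ≤ ρ x) (hD : ∀ x, x ∉ D → ρ x = 0) (x : X) :
    (A ∩ B ∩ C ∩ D)ᶜ.indicator ρ x ≤ Aᶜ.indicator ρ x + Bᶜ.indicator ρ x + Cᶜ.indicator ρ x := by
  have hA := Set.indicator_nonneg (fun y (_ : y ∈ Aᶜ) => hρ0 y) x
  have hB := Set.indicator_nonneg (fun y (_ : y ∈ Bᶜ) => hρ0 y) x
  have hC := Set.indicator_nonneg (fun y (_ : y ∈ Cᶜ) => hρ0 y) x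
  by_cases hx : x ∈ (A ∩ B ∩ C ∩ D)ᶜ
  · rw [Set.indicator_of_mem hx]
    simp only [Set.mem_compl_iff, Set.mem_inter_iff, not_and_or] at hx
    rcases hx with ((hxA | hxB) | hxC) | hxD
    · rw [Set.indicator_of_mem (Set.mem_compl hxA)]; linarith
    · rw [Set.indicator_of_mem (Set.mem_compl hxB)]; linarith
    · rw [Set.indicator_of_mem (Set.mem_compl hxC)]; linarith
    · rw [hD x hxD]; linarith
  · rw [Set.indicator_of_notMem hx]; linarith

omit [NeZero L] in
/-- From a pointwise domination by three indicators to the set integrals: `𝟙_S ρ ≤ 𝟙_P ρ + 𝟙_Q ρ + 𝟙_R ρ` ⇒ `∫_S ρ ≤ ∫_P ρ + ∫_Q ρ + ∫_R ρ`. [folklore] -/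
theorem setIntegral_le_three_of_indicator_le {X : Type*} [MeasurableSpace X] {μ : Measure X} {S P Q R : Set X} (hS : MeasurableSet S) (hP : MeasurableSet P)
    (hQ : MeasurableSet Q) (hR : MeasurableSet R) {ρ : X → ℝ} (hρi : Integrable ρ μ)
    (hpt : ∀ x, S.indicator ρ x ≤ P.indicator ρ x + Q.indicator ρ x + R.indicator ρ x) :
    ∫ x in S, ρ x ∂μ ≤ (∫ x in P, ρ x ∂μ) + (∫ x in Q, ρ x ∂μ) + ∫ x in R, ρ x ∂μ := by
  have hP' : Integrable (P.indicator ρ) μ := hρi.indicator hP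
  have hQ' : Integrable (Q.indicator ρ) μ := hρi.indicator hQ
  have hR' : Integrable (R.indicator ρ) μ := hρi.indicator hR
  have hPQ : Integrable (fun x => P.indicator ρ x + Q.indicator ρ x) μ := hP'.add hQ'
  have hPQR : Integrable (fun x => P.indicator ρ x + Q.indicator ρ x + R.indicator ρ x) μ := hPQ.add hR'
  have e1 : ∫ x, (P.indicator ρ x + Q.indicator ρ x + R.indicator ρ x) ∂μ = (∫ x, (P.indicator ρ x + Q.indicator ρ x) ∂μ) + ∫ x, R.indicator ρ x ∂μ := integral_add hPQ hR'
  have e2 : ∫ x, (P.indicator ρ x + Q.indicator ρ x) ∂μ = (∫ x, P.indicator ρ x ∂μ) + ∫ x, Q.indicator ρ x ∂μ := integral_add hP' hQ'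
  calc ∫ x in S, ρ x ∂μ = ∫ x, S.indicator ρ x ∂μ := (integral_indicator hS).symm
    _ ≤ ∫ x, (P.indicator ρ x + Q.indicator ρ x + R.indicator ρ x) ∂μ := integral_mono (hρi.indicator hS) hPQR hpt
    _ = (∫ x, P.indicator ρ x ∂μ) + (∫ x, Q.indicator ρ x ∂μ) + ∫ x, R.indicator ρ x ∂μ := by rw [e1, e2]
    _ = (∫ x in P, ρ x ∂μ) + (∫ x in Q, ρ x ∂μ) + ∫ x in R, ρ x ∂μ := by rw [integral_indicator hP, integral_indicator hQ, integral_indicator hR]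

omit [NeZero L] in
/-- Integrated: `∫_{(A∩B∩C∩D)ᶜ}ρ ≤ ∫_{Aᶜ}ρ + ∫_{Bᶜ}ρ + ∫_{Cᶜ}ρ`. [folklore] -/
theorem setIntegral_compl_core_le {X : Type*} [MeasurableSpace X] {μ : Measure X} {A B C D : Set X} (hA : MeasurableSet A) (hB : MeasurableSet B) (hC : MeasurableSet C)
    (hD : MeasurableSet D) {ρ : X → ℝ} (hρ0 : ∀ x, 0 ≤ ρ x) (hρi : Integrable ρ μ) (hDρ : ∀ x, x ∉ D → ρ x = 0) :
    ∫ x in (A ∩ B ∩ C ∩ D)ᶜ, ρ x ∂μ ≤ (∫ x in Aᶜ, ρ x ∂μ) + (∫ x in Bᶜ, ρ x ∂μ) + ∫ x in Cᶜ, ρ x ∂μ :=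
  setIntegral_le_three_of_indicator_le (((hA.inter hB).inter hC).inter hD).compl hA.compl hB.compl hC.compl hρi fun x => indicator_compl_core_le hρ0 hDρ x

/-! ## §2 ★★ The reference tail on the core -/

/-- The support set of the reference/slow densities: `{Ω(v̂) ≠ 0} ∩ {Ω(v̂′) ≠ 0} ∩ {fpWeight ε g ≠ 0}` is measurable. [folklore] -/
theorem measurableSet_tripleSupport {Ω : LinkSpace L → ℝ} (hΩm : Measurable Ω) (ε : ℝ) :
    MeasurableSet {p : (Edge 3 L → Fin 3 → ℝ) × ((Edge 3 L → Fin 3 → ℝ) × (Site 3 L → SU2)) | Ω (linkEmbed L p.1) ≠ 0 ∧ Ω (linkEmbed L p.2.1) ≠ 0 ∧ fpWeight L ε p.2.2 ≠ 0} := by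
  have hle := measurable_linkEmbed L
  have h1 : Measurable fun p : (Edge 3 L → Fin 3 → ℝ) × ((Edge 3 L → Fin 3 → ℝ) × (Site 3 L → SU2)) => Ω (linkEmbed L p.1) := hΩm.comp (hle.comp measurable_fst)
  have h2 : Measurable fun p : (Edge 3 L → Fin 3 → ℝ) × ((Edge 3 L → Fin 3 → ℝ) × (Site 3 L → SU2)) => Ω (linkEmbed L p.2.1) :=
    hΩm.comp (hle.comp (measurable_fst.comp measurable_snd))
  have h3 : Measurable fun p : (Edge 3 L → Fin 3 → ℝ) × ((Edge 3 L → Fin 3 → ℝ) × (Site 3 L → SU2)) => fpWeight L ε p.2.2 :=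
    (measurable_fpWeight L ε).comp (measurable_snd.comp measurable_snd)
  exact ((h1 (measurableSet_singleton 0).compl).inter ((h2 (measurableSet_singleton 0).compl).inter (h3 (measurableSet_singleton 0).compl)))

/-- Off the support every `fpTriple β Ω (fpWeight ε) u u'` vanishes. [folklore] -/
theorem fpTriple_eq_zero_of_not_support (β : ℝ) (Ω : LinkSpace L → ℝ) (ε : ℝ) (u u' : GaugeConfig 3 1 SU2)
    (p : (Edge 3 L → Fin 3 → ℝ) × ((Edge 3 L → Fin 3 → ℝ) × (Site 3 L → SU2)))
    (hp : p ∉ {p : (Edge 3 L → Fin 3 → ℝ) × ((Edge 3 L → Fin 3 → ℝ) × (Site 3 L → SU2)) | Ω (linkEmbed L p.1) ≠ 0 ∧ Ω (linkEmbed L p.2.1) ≠ 0 ∧ fpWeight L ε p.2.2 ≠ 0}) :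
    fpTriple L β Ω (fpWeight L ε) u u' p = 0 := by
  simp only [Set.mem_setOf_eq, not_and_or, not_not] at hp
  unfold fpTriple
  rcases hp with h | h | h
  · rw [h, zero_mul]
  · rw [h, mul_zero, mul_zero]
  · rw [h, zero_mul, zero_mul, mul_zero]

set_option maxHeartbeats 400000 in
/-- ★★ **THE REFERENCE TAIL ON THE CORE** `S′ = {βkin ≤ T} ∩ {β‖v̂‖² ≤ T} ∩ {β‖v̂′‖² ≤ T} ∩ supp`: given the kinetic tail `≤ η₁∫ρ₁` and the two fibre tails `≤ η₂∫ρ₁`, `≤ η₃∫ρ₁`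
(`reference_tail_le`, `reference_fibre_tail_le`, `reference_fibre_tail_le'`), `∫_{S′ᶜ}ρ₁ ≤ (η₁ + η₂ + η₃)∫ρ₁`. [folklore] -/
theorem reference_core_tail_le {β : ℝ} {Ω : LinkSpace L → ℝ} (hΩm : Measurable Ω) {CΩ : ℝ} (hCΩ : ∀ x, |Ω x| ≤ CΩ) (hΩ0 : ∀ x, 0 ≤ Ω x) (ε T : ℝ) {η₁ η₂ η₃ : ℝ}
    (h1 : ∫ p in {p : (Edge 3 L → Fin 3 → ℝ) × ((Edge 3 L → Fin 3 → ℝ) × (Site 3 L → SU2)) | T < β * kinDefect L (orthoTube L 1 p.1) (orthoTube L 1 p.2.1) p.2.2},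
        fpTriple L β Ω (fpWeight L ε) 1 1 p ∂((orthoTransverse L).prod ((orthoTransverse L).prod (gaugeMeasure L))) ≤
      η₁ * ∫ p, fpTriple L β Ω (fpWeight L ε) 1 1 p ∂((orthoTransverse L).prod ((orthoTransverse L).prod (gaugeMeasure L))))
    (h2 : ∫ p in {p : (Edge 3 L → Fin 3 → ℝ) × ((Edge 3 L → Fin 3 → ℝ) × (Site 3 L → SU2)) | T < β * ‖linkEmbed L p.1‖ ^ 2},
        fpTriple L β Ω (fpWeight L ε) 1 1 p ∂((orthoTransverse L).prod ((orthoTransverse L).prod (gaugeMeasure L))) ≤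
      η₂ * ∫ p, fpTriple L β Ω (fpWeight L ε) 1 1 p ∂((orthoTransverse L).prod ((orthoTransverse L).prod (gaugeMeasure L))))
    (h3 : ∫ p in {p : (Edge 3 L → Fin 3 → ℝ) × ((Edge 3 L → Fin 3 → ℝ) × (Site 3 L → SU2)) | T < β * ‖linkEmbed L p.2.1‖ ^ 2},
        fpTriple L β Ω (fpWeight L ε) 1 1 p ∂((orthoTransverse L).prod ((orthoTransverse L).prod (gaugeMeasure L))) ≤
      η₃ * ∫ p, fpTriple L β Ω (fpWeight L ε) 1 1 p ∂((orthoTransverse L).prod ((orthoTransverse L).prod (gaugeMeasure L)))) :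
    ∫ p in ({p : (Edge 3 L → Fin 3 → ℝ) × ((Edge 3 L → Fin 3 → ℝ) × (Site 3 L → SU2)) | β * kinDefect L (orthoTube L 1 p.1) (orthoTube L 1 p.2.1) p.2.2 ≤ T} ∩
          {p | β * ‖linkEmbed L p.1‖ ^ 2 ≤ T} ∩ {p | β * ‖linkEmbed L p.2.1‖ ^ 2 ≤ T} ∩
          {p | Ω (linkEmbed L p.1) ≠ 0 ∧ Ω (linkEmbed L p.2.1) ≠ 0 ∧ fpWeight L ε p.2.2 ≠ 0})ᶜ,
        fpTriple L β Ω (fpWeight L ε) 1 1 p ∂((orthoTransverse L).prod ((orthoTransverse L).prod (gaugeMeasure L))) ≤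
      (η₁ + η₂ + η₃) * ∫ p, fpTriple L β Ω (fpWeight L ε) 1 1 p ∂((orthoTransverse L).prod ((orthoTransverse L).prod (gaugeMeasure L))) := by
  haveI := isFiniteMeasure_orthoTransverse L
  haveI : SecondCountableTopology SU2 := secondCountableTopology_su2
  have hle := measurable_linkEmbed L
  have hNm := ((continuous_kinDefect_joint (L := L)).measurable.comp
    (((measurable_orthoTube_right (L := L) 1).comp measurable_fst).prodMk
      (((measurable_orthoTube_right (L := L) 1).comp (measurable_fst.comp measurable_snd)).prodMk (measurable_snd.comp measurable_snd)))).const_mul β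
  have hA : MeasurableSet {p : (Edge 3 L → Fin 3 → ℝ) × ((Edge 3 L → Fin 3 → ℝ) × (Site 3 L → SU2)) | β * kinDefect L (orthoTube L 1 p.1) (orthoTube L 1 p.2.1) p.2.2 ≤ T} :=
    measurableSet_le hNm measurable_const
  have hB : MeasurableSet {p : (Edge 3 L → Fin 3 → ℝ) × ((Edge 3 L → Fin 3 → ℝ) × (Site 3 L → SU2)) | β * ‖linkEmbed L p.1‖ ^ 2 ≤ T} :=
    measurableSet_le (((hle.comp measurable_fst).norm.pow_const 2).const_mul β) measurable_const
  have hC : MeasurableSet {p : (Edge 3 L → Fin 3 → ℝ) × ((Edge 3 L → Fin 3 → ℝ) × (Site 3 L → SU2)) | β * ‖linkEmbed L p.2.1‖ ^ 2 ≤ T} :=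
    measurableSet_le (((hle.comp (measurable_fst.comp measurable_snd)).norm.pow_const 2).const_mul β) measurable_const
  have hD := measurableSet_tripleSupport (L := L) hΩm ε
  obtain ⟨Bρ, hBρ⟩ := abs_fpTriple_le (L := L) β hCΩ (CW := 1) (fun g => by rw [abs_of_nonneg (fpWeight_mem_Icc L ε g).1]; exact (fpWeight_mem_Icc L ε g).2) (1 : GaugeConfig 3 1 SU2) 1
  have hρm : Measurable fun p => fpTriple L β Ω (fpWeight L ε) 1 1 p := measurable_fpTriple β hΩm (measurable_fpWeight L ε) 1 1
  have hρi : Integrable (fun p => fpTriple L β Ω (fpWeight L ε) 1 1 p) ((orthoTransverse L).prod ((orthoTransverse L).prod (gaugeMeasure L))) :=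
    integrable_of_measurable_abs_le _ hρm hBρ
  have hρ0 : ∀ p, 0 ≤ fpTriple L β Ω (fpWeight L ε) 1 1 p := fun p => by
    unfold fpTriple; exact mul_nonneg (hΩ0 _) (mul_nonneg (mul_nonneg (fpWeight_mem_Icc L ε _).1 (transferKernel_pos _ _ _ _).le) (hΩ0 _))
  have h := setIntegral_compl_core_le hA hB hC hD hρ0 hρi (fun p hp => fpTriple_eq_zero_of_not_support β Ω ε 1 1 p hp)
  -- the complements are the strict super-level sets
  have eA : {p : (Edge 3 L → Fin 3 → ℝ) × ((Edge 3 L → Fin 3 → ℝ) × (Site 3 L → SU2)) | β * kinDefect L (orthoTube L 1 p.1) (orthoTube L 1 p.2.1) p.2.2 ≤ T}ᶜ =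
      {p | T < β * kinDefect L (orthoTube L 1 p.1) (orthoTube L 1 p.2.1) p.2.2} := by ext p; simp
  have eB : {p : (Edge 3 L → Fin 3 → ℝ) × ((Edge 3 L → Fin 3 → ℝ) × (Site 3 L → SU2)) | β * ‖linkEmbed L p.1‖ ^ 2 ≤ T}ᶜ = {p | T < β * ‖linkEmbed L p.1‖ ^ 2} := by ext p; simp
  have eC : {p : (Edge 3 L → Fin 3 → ℝ) × ((Edge 3 L → Fin 3 → ℝ) × (Site 3 L → SU2)) | β * ‖linkEmbed L p.2.1‖ ^ 2 ≤ T}ᶜ = {p | T < β * ‖linkEmbed L p.2.1‖ ^ 2} := by ext p; simp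
  rw [eA, eB, eC] at h
  linarith [h, h1, h2, h3]

/-! ## §3 ★★ The slow tail on the core -/

set_option maxHeartbeats 800000 in
/-- ★★ **THE SLOW TAIL ON THE CORE.**  Slow datum `w` with `‖q(w_k) − 1‖ ≤ τ_u`, colour pinning of radius `ε ≥ 0`, fibre radius `r_T` with `β·r_T² = T` … more precisely: on
`{β‖v̂‖² ≤ T}` one has `‖v̂‖ ≤ r_T` (hypothesis `hrT : ∀ r, β r² ≤ T → r ≤ r_T` for `r ≥ 0`), the smallness hypotheses of `kinDefect_slow_gt_of_one_gt` at `(D, r_T)` with `D = T′/β`, and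
`T/β ≥ 2D + 8|E|τ_u²Φ²`.  Then from the slow kinetic tail `∫_{T′ < βkin_w}ρ_w/K ≤ X₁` and the crude slow fibre tails `≤ X₂`, `≤ X₃`:  `∫_{S′ᶜ}ρ_w/K(w,w) ≤ X₁ + X₂ + X₃`. [folklore] -/
theorem slow_core_tail_le {β : ℝ} (hβ : 0 < β) (w : GaugeConfig 3 1 SU2) {τu : ℝ} (hτu0 : 0 ≤ τu) (hwτ : ∀ k : Fin 3, ‖su2Quat (w (0, k)) - 1‖ ≤ τu)
    {Ω : LinkSpace L → ℝ} (hΩm : Measurable Ω) {CΩ : ℝ} (hCΩ : ∀ x, |Ω x| ≤ CΩ) (hΩ0 : ∀ x, 0 ≤ Ω x)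
    (hΩc : ∀ v : Edge 3 L → Fin 3 → ℝ, Ω (linkEmbed L v) ≠ 0 → v ∈ capBalancedSet L) {ε : ℝ} (hε0 : 0 ≤ ε) (T : ℝ) {rT D : ℝ}
    (hrT : ∀ r : ℝ, 0 ≤ r → β * r ^ 2 ≤ T → r ≤ rT)
    (hsmall : 3 * L * (Real.sqrt D + 4 * (Real.sqrt 2 * rT + τu) + Real.sqrt 2 * (rT + rT)) < 1)
    (htwo : 9 * L * (Real.sqrt D + 4 * (Real.sqrt 2 * rT + τu) + Real.sqrt 2 * (rT + rT)) + ε ≤ 2)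
    (hTD : β * (2 * D + 8 * (Fintype.card (Edge 3 L) : ℝ) * τu ^ 2 *
      ((9 * L * (Real.sqrt D + Real.sqrt 2 * (rT + rT)) + ε) * (1 + 18 * L * (Real.sqrt 2 * rT + τu) + (18 * L * (Real.sqrt 2 * rT + τu)) ^ 2) +
        (18 * L * (Real.sqrt 2 * rT + τu)) ^ 2 * (36 * L * (Real.sqrt 2 * rT + τu))) ^ 2) ≤ T)
    {X₁ X₂ X₃ : ℝ}
    (h1 : (∫ p in {p : (Edge 3 L → Fin 3 → ℝ) × ((Edge 3 L → Fin 3 → ℝ) × (Site 3 L → SU2)) | β * D < β * kinDefect L (orthoTube L w p.1) (orthoTube L w p.2.1) p.2.2},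
        fpTriple L β Ω (fpWeight L ε) w w p ∂((orthoTransverse L).prod ((orthoTransverse L).prod (gaugeMeasure L)))) / transferKernel su2Rep ((L : ℝ) ^ 3 * β) w w ≤ X₁)
    (h2 : (∫ p in {p : (Edge 3 L → Fin 3 → ℝ) × ((Edge 3 L → Fin 3 → ℝ) × (Site 3 L → SU2)) | p.1 ∈ {v : Edge 3 L → Fin 3 → ℝ | T < β * ‖linkEmbed L v‖ ^ 2} ∧ p.2.1 ∈ (Set.univ : Set (Edge 3 L → Fin 3 → ℝ))},
        fpTriple L β Ω (fpWeight L ε) w w p ∂((orthoTransverse L).prod ((orthoTransverse L).prod (gaugeMeasure L)))) / transferKernel su2Rep ((L : ℝ) ^ 3 * β) w w ≤ X₂)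
    (h3 : (∫ p in {p : (Edge 3 L → Fin 3 → ℝ) × ((Edge 3 L → Fin 3 → ℝ) × (Site 3 L → SU2)) | p.1 ∈ (Set.univ : Set (Edge 3 L → Fin 3 → ℝ)) ∧ p.2.1 ∈ {v : Edge 3 L → Fin 3 → ℝ | T < β * ‖linkEmbed L v‖ ^ 2}},
        fpTriple L β Ω (fpWeight L ε) w w p ∂((orthoTransverse L).prod ((orthoTransverse L).prod (gaugeMeasure L)))) / transferKernel su2Rep ((L : ℝ) ^ 3 * β) w w ≤ X₃) :
    (∫ p in ({p : (Edge 3 L → Fin 3 → ℝ) × ((Edge 3 L → Fin 3 → ℝ) × (Site 3 L → SU2)) | β * kinDefect L (orthoTube L 1 p.1) (orthoTube L 1 p.2.1) p.2.2 ≤ T} ∩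
          {p | β * ‖linkEmbed L p.1‖ ^ 2 ≤ T} ∩ {p | β * ‖linkEmbed L p.2.1‖ ^ 2 ≤ T} ∩
          {p | Ω (linkEmbed L p.1) ≠ 0 ∧ Ω (linkEmbed L p.2.1) ≠ 0 ∧ fpWeight L ε p.2.2 ≠ 0})ᶜ,
        fpTriple L β Ω (fpWeight L ε) w w p ∂((orthoTransverse L).prod ((orthoTransverse L).prod (gaugeMeasure L)))) / transferKernel su2Rep ((L : ℝ) ^ 3 * β) w w ≤
      X₁ + X₂ + X₃ := by
  haveI := isFiniteMeasure_orthoTransverse L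
  haveI : SecondCountableTopology SU2 := secondCountableTopology_su2
  set μP : Measure ((Edge 3 L → Fin 3 → ℝ) × ((Edge 3 L → Fin 3 → ℝ) × (Site 3 L → SU2))) := (orthoTransverse L).prod ((orthoTransverse L).prod (gaugeMeasure L)) with hμP
  set Kw : ℝ := transferKernel su2Rep ((L : ℝ) ^ 3 * β) w w with hKw
  have hKwp : 0 < Kw := transferKernel_pos _ _ _ _
  have hle := measurable_linkEmbed L
  -- the sets
  set A := {p : (Edge 3 L → Fin 3 → ℝ) × ((Edge 3 L → Fin 3 → ℝ) × (Site 3 L → SU2)) | β * kinDefect L (orthoTube L 1 p.1) (orthoTube L 1 p.2.1) p.2.2 ≤ T} with hAdef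
  set B := {p : (Edge 3 L → Fin 3 → ℝ) × ((Edge 3 L → Fin 3 → ℝ) × (Site 3 L → SU2)) | β * ‖linkEmbed L p.1‖ ^ 2 ≤ T} with hBdef
  set C := {p : (Edge 3 L → Fin 3 → ℝ) × ((Edge 3 L → Fin 3 → ℝ) × (Site 3 L → SU2)) | β * ‖linkEmbed L p.2.1‖ ^ 2 ≤ T} with hCdef
  set Dset := {p : (Edge 3 L → Fin 3 → ℝ) × ((Edge 3 L → Fin 3 → ℝ) × (Site 3 L → SU2)) | Ω (linkEmbed L p.1) ≠ 0 ∧ Ω (linkEmbed L p.2.1) ≠ 0 ∧ fpWeight L ε p.2.2 ≠ 0} with hDdef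
  set Aw := {p : (Edge 3 L → Fin 3 → ℝ) × ((Edge 3 L → Fin 3 → ℝ) × (Site 3 L → SU2)) | β * D < β * kinDefect L (orthoTube L w p.1) (orthoTube L w p.2.1) p.2.2} with hAwdef
  set Bc := {p : (Edge 3 L → Fin 3 → ℝ) × ((Edge 3 L → Fin 3 → ℝ) × (Site 3 L → SU2)) | p.1 ∈ {v : Edge 3 L → Fin 3 → ℝ | T < β * ‖linkEmbed L v‖ ^ 2} ∧ p.2.1 ∈ (Set.univ : Set (Edge 3 L → Fin 3 → ℝ))} with hBcdef
  set Cc := {p : (Edge 3 L → Fin 3 → ℝ) × ((Edge 3 L → Fin 3 → ℝ) × (Site 3 L → SU2)) | p.1 ∈ (Set.univ : Set (Edge 3 L → Fin 3 → ℝ)) ∧ p.2.1 ∈ {v : Edge 3 L → Fin 3 → ℝ | T < β * ‖linkEmbed L v‖ ^ 2}} with hCcdef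
  have hNm1 := ((continuous_kinDefect_joint (L := L)).measurable.comp
    (((measurable_orthoTube_right (L := L) 1).comp measurable_fst).prodMk
      (((measurable_orthoTube_right (L := L) 1).comp (measurable_fst.comp measurable_snd)).prodMk (measurable_snd.comp measurable_snd)))).const_mul β
  have hNmw := ((continuous_kinDefect_joint (L := L)).measurable.comp
    (((measurable_orthoTube_right (L := L) w).comp measurable_fst).prodMk
      (((measurable_orthoTube_right (L := L) w).comp (measurable_fst.comp measurable_snd)).prodMk (measurable_snd.comp measurable_snd)))).const_mul β
  have hA : MeasurableSet A := measurableSet_le hNm1 measurable_const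
  have hB : MeasurableSet B := measurableSet_le (((hle.comp measurable_fst).norm.pow_const 2).const_mul β) measurable_const
  have hC : MeasurableSet C := measurableSet_le (((hle.comp (measurable_fst.comp measurable_snd)).norm.pow_const 2).const_mul β) measurable_const
  have hD : MeasurableSet Dset := measurableSet_tripleSupport (L := L) hΩm ε
  have hAw : MeasurableSet Aw := measurableSet_lt measurable_const hNmw
  have hBc : MeasurableSet Bc := by
    rw [hBcdef]
    exact (measurable_fst (measurableSet_lt measurable_const ((hle.norm.pow_const 2).const_mul β))).inter ((measurable_fst.comp measurable_snd) MeasurableSet.univ)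
  have hCc : MeasurableSet Cc := by
    rw [hCcdef]
    exact (measurable_fst MeasurableSet.univ).inter ((measurable_fst.comp measurable_snd) (measurableSet_lt measurable_const ((hle.norm.pow_const 2).const_mul β)))
  -- the density
  set ρ : ((Edge 3 L → Fin 3 → ℝ) × ((Edge 3 L → Fin 3 → ℝ) × (Site 3 L → SU2))) → ℝ := fun p => fpTriple L β Ω (fpWeight L ε) w w p / Kw with hρ
  obtain ⟨Bρ, hBρ⟩ := abs_fpTriple_le (L := L) β hCΩ (CW := 1) (fun g => by rw [abs_of_nonneg (fpWeight_mem_Icc L ε g).1]; exact (fpWeight_mem_Icc L ε g).2) w w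
  have hρm : Measurable ρ := (measurable_fpTriple β hΩm (measurable_fpWeight L ε) w w).div_const _
  have hρi : Integrable ρ μP := integrable_of_measurable_abs_le _ hρm (C := Bρ / Kw) fun p => by
    rw [hρ]; dsimp only; rw [abs_div, abs_of_pos hKwp]; exact div_le_div_of_nonneg_right (hBρ p) hKwp.le
  have hρ0 : ∀ p, 0 ≤ ρ p := fun p => by
    rw [hρ]; dsimp only; unfold fpTriple
    exact div_nonneg (mul_nonneg (hΩ0 _) (mul_nonneg (mul_nonneg (fpWeight_mem_Icc L ε _).1 (transferKernel_pos _ _ _ _).le) (hΩ0 _))) hKwp.le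
  have hρD : ∀ p, p ∉ Dset → ρ p = 0 := fun p hp => by rw [hρ]; dsimp only; rw [fpTriple_eq_zero_of_not_support β Ω ε w w p hp, zero_div]
  -- pointwise: `𝟙_{S′ᶜ}ρ ≤ 𝟙_{Aw}ρ + 𝟙_{Bc}ρ + 𝟙_{Cc}ρ`
  have hpt : ∀ p, (A ∩ B ∩ C ∩ Dset)ᶜ.indicator ρ p ≤ Aw.indicator ρ p + Bc.indicator ρ p + Cc.indicator ρ p := by
    intro p
    have i1 := Set.indicator_nonneg (fun y (_ : y ∈ Aw) => hρ0 y) p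
    have i2 := Set.indicator_nonneg (fun y (_ : y ∈ Bc) => hρ0 y) p
    have i3 := Set.indicator_nonneg (fun y (_ : y ∈ Cc) => hρ0 y) p
    by_cases hp : p ∈ (A ∩ B ∩ C ∩ Dset)ᶜ
    · rw [Set.indicator_of_mem hp]
      by_cases hpB : p ∈ B
      · by_cases hpC : p ∈ C
        · by_cases hpD : p ∈ Dset
          · -- then `p ∉ A`: the kinetic tail at `1`, hence at `w`
            have hpA : p ∉ A := fun h => hp (by exact ⟨⟨⟨h, hpB⟩, hpC⟩, hpD⟩)
            have hgt : T < β * kinDefect L (orthoTube L 1 p.1) (orthoTube L 1 p.2.1) p.2.2 := by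
              rw [hAdef] at hpA; simp only [Set.mem_setOf_eq, not_le] at hpA; exact hpA
            obtain ⟨hv0, hv'0, hg0⟩ := hpD
            have hvc := hΩc _ hv0
            have hv'c := hΩc _ hv'0
            have hv1 : ∀ e, ∑ a, p.1 e a ^ 2 ≤ 1 := sum_sq_le_one_of_cap L hvc.2
            have hv'1 : ∀ e, ∑ a, p.2.1 e a ^ 2 ≤ 1 := sum_sq_le_one_of_cap L hv'c.2
            have hvr : ‖linkEmbed L p.1‖ ≤ rT := hrT _ (norm_nonneg _) hpB
            have hv'r : ‖linkEmbed L p.2.1‖ ≤ rT := hrT _ (norm_nonneg _) hpC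
            have hW : colourMean L p.2.2 ∈ fpBall ε := by
              by_contra hno
              apply hg0
              unfold fpWeight; rw [Set.indicator_of_notMem hno]
            have hkin1 : 2 * D + 8 * (Fintype.card (Edge 3 L) : ℝ) * τu ^ 2 *
                ((9 * L * (Real.sqrt D + Real.sqrt 2 * (rT + rT)) + ε) * (1 + 18 * L * (Real.sqrt 2 * rT + τu) + (18 * L * (Real.sqrt 2 * rT + τu)) ^ 2) +
                  (18 * L * (Real.sqrt 2 * rT + τu)) ^ 2 * (36 * L * (Real.sqrt 2 * rT + τu))) ^ 2 < kinDefect L (orthoTube L 1 p.1) (orthoTube L 1 p.2.1) p.2.2 := by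
              by_contra hno
              push Not at hno
              have := mul_le_mul_of_nonneg_left hno hβ.le
              linarith
            have hD' := kinDefect_slow_gt_of_one_gt (L := L) w hv1 hv'1 hτu0 hε0 hvr hv'r hwτ hW hsmall htwo hkin1
            have hpAw : p ∈ Aw := by
              rw [hAwdef]; simp only [Set.mem_setOf_eq]; exact mul_lt_mul_of_pos_left hD' hβ
            rw [Set.indicator_of_mem hpAw]; linarith
          · rw [hρD p hpD]; linarith
        · have hpCc : p ∈ Cc := by
            rw [hCcdef]; refine ⟨Set.mem_univ _, ?_⟩
            rw [hCdef] at hpC; simp only [Set.mem_setOf_eq, not_le] at hpC; exact hpC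
          rw [Set.indicator_of_mem hpCc]; linarith
      · have hpBc : p ∈ Bc := by
          rw [hBcdef]; refine ⟨?_, Set.mem_univ _⟩
          rw [hBdef] at hpB; simp only [Set.mem_setOf_eq, not_le] at hpB; exact hpB
        rw [Set.indicator_of_mem hpBc]; linarith
    · rw [Set.indicator_of_notMem hp]; linarith
  have hS : MeasurableSet (A ∩ B ∩ C ∩ Dset)ᶜ := (((hA.inter hB).inter hC).inter hD).compl
  have hint : ∫ p in (A ∩ B ∩ C ∩ Dset)ᶜ, ρ p ∂μP ≤ (∫ p in Aw, ρ p ∂μP) + (∫ p in Bc, ρ p ∂μP) + ∫ p in Cc, ρ p ∂μP :=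
    setIntegral_le_three_of_indicator_le hS hAw hBc hCc hρi hpt
  -- convert the set integrals of `ρ = fpTriple/Kw` into the hypotheses' form
  have hconv : ∀ S : Set ((Edge 3 L → Fin 3 → ℝ) × ((Edge 3 L → Fin 3 → ℝ) × (Site 3 L → SU2))),
      ∫ p in S, ρ p ∂μP = (∫ p in S, fpTriple L β Ω (fpWeight L ε) w w p ∂μP) / Kw := fun S => by rw [hρ]; dsimp only; rw [integral_div]
  rw [hconv, hconv, hconv, hconv] at hint
  linarith [hint, h1, h2, h3]

end Summit.QuantumFields.YangMills.Theorems.FemtoTransferGap.RateTube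

end
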